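import Mathlib.Data.Real.Basic
import Mathlib.Algebra.Order.BigOperators.Ring.Finset
import Mathlib.Tactic.Abel
import Literature.Computability.AlgebraicComplexity.LaserHashing
import HarnessLib

/-!
# The Toeplitz (Hankel) pairwise-independent generator and its hitting property for measures

Topic `Computability/Complexity`. A seed of `O(N)` bits must produce `k ≤ 2ᵐ` vectors
`v₀, …, v_{k-1} ∈ 𝔽₂ᴺ` that are **pairwise independent** (each uniform, each pair uniform on
`𝔽₂ᴺ × 𝔽₂ᴺ`); the classical solution is `vᵢ = T·cᵢ + b` with `T` a random TOEPLITZ matrix (here in the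
Hankel indexing `T_{r,c} = t_{r+c}`, `N + m` random bits), `b` a random shift (`N` bits) and `cᵢ ∈ 𝔽₂ᵐ`
distinct index vectors — seed length `2N + m` instead of the `N m + N` of a full random matrix
(Goldreich, *A sample of samplers*, 2011, App. C / Hirahara, ECCC TR22-119, proof of Lemma 8.1: "the
pairwise-independent hitter constructed by using Toeplitz matrices [Gol11]"). Pairwise independence
makes Chebyshev's inequality available, whence the **hitting property** used in derandomized hardness
amplification (Hirahara CCC 2020, Lemma 68; FOCS 2022, Lemma 8.1): `k = O(1/εδ)` pairwise independent
samples land in any set of density `δ` except with probability `ε` — here in the slightly more general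
form for MEASURES `μ : 𝔽₂ᴺ → [0,1]` that the measure version of the hard-core lemma needs.

Everything is PROVED:

* `Hankel.exists_solve` — for `x ≠ 0` the Hankel system `∑_c t_{r+c} x_c = y_r` (`r < N`) is solvable
  in `t ∈ 𝔽₂^{N+m}` for every right-hand side (back-substitution along the pivots `r + max supp x`);
* `Hankel.gen`, `card_filter_gen_eq`, `card_filter_gen_pair` — the generator and its one-point
  uniformity / pairwise independence as exact fibre counts (fibres of onto additive maps, via the
  tree's `card_filter_mul_card_eq_card_of_surjective`);
* `PairwiseUniform.sum_sq_sum_eq` / `sum_sq_dev_le` / `card_sum_le_half_mul_le` — **Chebyshev for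
  pairwise-uniform families** (generic): for maps `X_i : Y → V` that are singly and pairwise uniform and any
  `μ : V → ℝ` with `0 ≤ μ ≤ 1`, `∑_y (∑_i μ(X_i y) - k μ̄)² ≤ k |Y| μ̄`, hence
  `#{y | ∑_i μ(X_i y) ≤ k μ̄ / 2} · k μ̄ ≤ 4 |Y|`;
* `Hankel.card_sum_le_half_mul_le` — the hitting property of the Hankel generator for measures.

## References

* O. Goldreich, *A sample of samplers: a computational perspective on sampling*, in: Studies in
  Complexity and Cryptography, LNCS 6650 (2011), App. C (pairwise-independent generators from Toeplitz
  matrices) [Gol11, as cited by Hirahara 2022].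
* S. Hirahara, *NP-hardness of learning programs and partial MCSP*, ECCC TR22-119, proof of Lemma 8.1
  (p. 25: the Toeplitz hitter, `k = 1/εδ`) [Hirahara2022PartialMCSP].
* S. Hirahara, *Non-disjoint promise problems …*, CCC 2020, App. A, Lemma 68 and Lemma 72.
* S. Arora, B. Barak, *Computational Complexity: A Modern Approach*, CUP 2009, Def. 8.14–Thm. 8.15
  (pairwise independent hash families), Lemma A.11 (Chebyshev).
-/

namespace Literature.Computability.Complexity

open Finset

/-! ### Chebyshev for pairwise-uniform families of maps -/

namespace PairwiseUniform

variable {Y V : Type*} [Fintype Y] [Fintype V] [DecidableEq V] {k : ℕ}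

/-- A family of maps `X_i : Y → V` is **singly uniform** if every `X_i` has fibres of equal size
(`#{y | X_i y = v} · |V| = |Y|`). [cite: AroraBarak2009, Def. 8.14] -/
def Uniform1 (X : Fin k → Y → V) : Prop :=
  ∀ i v, (univ.filter fun y => X i y = v).card * Fintype.card V = Fintype.card Y

/-- … and **pairwise uniform** (pairwise independent) if for `i ≠ j` the pair map `(X_i, X_j)` has
fibres of equal size (`#{y | X_i y = v ∧ X_j y = w} · |V|² = |Y|`). [cite: AroraBarak2009, Def. 8.14] -/
def Uniform2 (X : Fin k → Y → V) : Prop :=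
  ∀ i j, i ≠ j → ∀ v w, (univ.filter fun y => X i y = v ∧ X j y = w).card *
    (Fintype.card V * Fintype.card V) = Fintype.card Y

variable {X : Fin k → Y → V}

/-- Averaging a function of `X_i y` over `y` is averaging over `V`:
`∑_y g(X_i y) · |V| = |Y| · ∑_v g(v)`. [folklore] -/
theorem sum_comp_eq (h1 : Uniform1 X) (i : Fin k) (g : V → ℝ) :
    (∑ y, g (X i y)) * Fintype.card V = Fintype.card Y * ∑ v, g v := by
  classical
  rw [← Finset.sum_fiberwise_of_maps_to (s := (univ : Finset Y)) (t := (univ : Finset V))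
    (g := fun y => X i y) (fun _ _ => mem_univ _)]
  rw [Finset.sum_mul, Finset.mul_sum]
  refine sum_congr rfl fun v _ => ?_
  have hc : ∑ y ∈ univ.filter (fun y => X i y = v), g (X i y) =
      ((univ.filter fun y => X i y = v).card : ℝ) * g v := by
    rw [sum_congr rfl fun y hy => by rw [(mem_filter.1 hy).2], sum_const, nsmul_eq_mul]
  rw [hc]
  have h := h1 i v
  have h' : ((univ.filter fun y => X i y = v).card : ℝ) * Fintype.card V = Fintype.card Y := by
    exact_mod_cast h
  calc ((univ.filter fun y => X i y = v).card : ℝ) * g v * Fintype.card V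
      = ((univ.filter fun y => X i y = v).card : ℝ) * Fintype.card V * g v := by ring
    _ = Fintype.card Y * g v := by rw [h']

/-- Averaging a function of `(X_i y, X_j y)` (`i ≠ j`) over `y` is averaging over `V × V`:
`∑_y g(X_i y, X_j y) · |V|² = |Y| · ∑_{v,w} g(v,w)`. [folklore] -/
theorem sum_comp_pair_eq (h2 : Uniform2 X) {i j : Fin k} (hij : i ≠ j) (g : V → V → ℝ) :
    (∑ y, g (X i y) (X j y)) * (Fintype.card V * Fintype.card V) =
      Fintype.card Y * ∑ v, ∑ w, g v w := by
  classical
  rw [← Finset.sum_fiberwise_of_maps_to (s := (univ : Finset Y)) (t := (univ : Finset (V × V)))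
    (g := fun y => (X i y, X j y)) (fun _ _ => mem_univ _)]
  rw [Finset.sum_mul, ← Finset.sum_product', Finset.mul_sum, univ_product_univ]
  refine sum_congr rfl fun vw _ => ?_
  obtain ⟨v, w⟩ := vw
  have hc : ∑ y ∈ univ.filter (fun y => (X i y, X j y) = (v, w)), g (X i y) (X j y) =
      ((univ.filter fun y => X i y = v ∧ X j y = w).card : ℝ) * g v w := by
    have hs : (univ.filter fun y => (X i y, X j y) = (v, w)) =
        univ.filter fun y => X i y = v ∧ X j y = w := by
      ext y; simp [Prod.ext_iff]
    rw [hs, sum_congr rfl fun y hy => by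
      obtain ⟨h1, h2⟩ := (mem_filter.1 hy).2; rw [h1, h2], sum_const, nsmul_eq_mul]
  rw [hc]
  have h' : ((univ.filter fun y => X i y = v ∧ X j y = w).card : ℝ) *
      (Fintype.card V * Fintype.card V) = Fintype.card Y := by exact_mod_cast h2 i j hij v w
  calc ((univ.filter fun y => X i y = v ∧ X j y = w).card : ℝ) * g v w *
        (Fintype.card V * Fintype.card V)
      = ((univ.filter fun y => X i y = v ∧ X j y = w).card : ℝ) *
          (Fintype.card V * Fintype.card V) * g v w := by ring
    _ = Fintype.card Y * g v w := by rw [h']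

/-- **The variance identity.** For a singly and pairwise uniform family and `φ : V → ℝ` with mean
zero (`∑_v φ v = 0`): `∑_y (∑_i φ(X_i y))² · |V| = |Y| · k · ∑_v φ(v)²` (cross terms vanish by
pairwise uniformity). [cite: AroraBarak2009, Lemma A.11 (Chebyshev) with Def. 8.14] -/
theorem sum_sq_sum_eq (h1 : Uniform1 X) (h2 : Uniform2 X) (φ : V → ℝ) (hφ : ∑ v, φ v = 0)
    (hV : 0 < Fintype.card V) :
    (∑ y, (∑ i, φ (X i y)) ^ 2) * Fintype.card V = Fintype.card Y * (k * ∑ v, φ v ^ 2) := by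
  have hVR : (0 : ℝ) < Fintype.card V := by exact_mod_cast hV
  -- expand the square
  have hexp : ∀ y, (∑ i, φ (X i y)) ^ 2 =
      ∑ i, φ (X i y) ^ 2 + ∑ i, ∑ j ∈ univ.filter (fun j => j ≠ i), φ (X i y) * φ (X j y) := by
    intro y
    rw [sq, Finset.sum_mul_sum, ← Finset.sum_add_distrib]
    refine sum_congr rfl fun i _ => ?_
    rw [← Finset.sum_filter_add_sum_filter_not univ (fun j => j = i), Finset.filter_eq',
      if_pos (mem_univ i), sum_singleton, sq]
  simp_rw [hexp]
  rw [Finset.sum_add_distrib, add_mul]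
  -- diagonal terms
  have hdiag : (∑ y, ∑ i, φ (X i y) ^ 2) * Fintype.card V = Fintype.card Y * (k * ∑ v, φ v ^ 2) := by
    rw [Finset.sum_comm, Finset.sum_mul]
    simp_rw [sum_comp_eq h1 _ (fun v => φ v ^ 2)]
    rw [sum_const, card_univ, Fintype.card_fin, nsmul_eq_mul]
    ring
  -- cross terms vanish
  have hcross : (∑ y, ∑ i, ∑ j ∈ univ.filter (fun j => j ≠ i), φ (X i y) * φ (X j y)) *
      Fintype.card V = 0 := by
    rw [Finset.sum_comm, Finset.sum_mul]
    refine Finset.sum_eq_zero fun i _ => ?_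
    rw [Finset.sum_comm, Finset.sum_mul]
    refine Finset.sum_eq_zero fun j hj => ?_
    have hij : i ≠ j := fun h => (mem_filter.1 hj).2 h.symm
    have h := sum_comp_pair_eq h2 hij (fun v w => φ v * φ w)
    have hzero : ∑ v, ∑ w, φ v * φ w = 0 := by
      rw [← Finset.sum_mul_sum, hφ, zero_mul]
    rw [hzero, mul_zero] at h
    -- `S * |V|² = 0` gives `S * |V| = 0`
    have : (∑ y, φ (X i y) * φ (X j y)) = 0 := by
      rcases mul_eq_zero.1 h with h0 | h0
      · exact h0
      · exfalso; exact absurd h0 (by positivity)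
    rw [this, zero_mul]
  rw [hdiag, hcross, add_zero]

/-- **Chebyshev for pairwise-uniform samples of a measure.** For `μ : V → [0,1]` with mean
`μ̄ = (∑ μ)/|V|`: `∑_y (∑_i μ(X_i y) - k μ̄)² ≤ |Y| · k · μ̄` (variance `≤ E[μ²] ≤ E[μ] = μ̄`).
[cite: AroraBarak2009, Lemma A.11 (Chebyshev)] -/
theorem sum_sq_dev_le (h1 : Uniform1 X) (h2 : Uniform2 X) (μ : V → ℝ) (hμ0 : ∀ v, 0 ≤ μ v)
    (hμ1 : ∀ v, μ v ≤ 1) (hV : 0 < Fintype.card V) :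
    ∑ y, (∑ i, μ (X i y) - k * ((∑ v, μ v) / Fintype.card V)) ^ 2 ≤
      Fintype.card Y * (k * ((∑ v, μ v) / Fintype.card V)) := by
  have hVR : (0 : ℝ) < Fintype.card V := by exact_mod_cast hV
  set mbar := (∑ v, μ v) / Fintype.card V with hmbar
  -- centre
  set φ : V → ℝ := fun v => μ v - mbar with hφ
  have hφ0 : ∑ v, φ v = 0 := by
    simp only [hφ, Finset.sum_sub_distrib, sum_const, card_univ, nsmul_eq_mul, hmbar]
    field_simp; ring
  have hdev : ∀ y, ∑ i, μ (X i y) - k * mbar = ∑ i, φ (X i y) := fun y => by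
    simp only [hφ, Finset.sum_sub_distrib, sum_const, card_univ, Fintype.card_fin, nsmul_eq_mul]
  simp_rw [hdev]
  have h := sum_sq_sum_eq h1 h2 φ hφ0 hV
  -- `∑_v φ² ≤ ∑_v μ² - |V| mbar² ≤ ∑ μ = |V| mbar`
  have hvar : ∑ v, φ v ^ 2 ≤ Fintype.card V * mbar := by
    have hexp : ∑ v, φ v ^ 2 = ∑ v, μ v ^ 2 - Fintype.card V * mbar ^ 2 := by
      have : ∀ v, φ v ^ 2 = μ v ^ 2 - 2 * mbar * μ v + mbar ^ 2 := fun v => by rw [hφ]; ring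
      simp only [this, Finset.sum_add_distrib, Finset.sum_sub_distrib, ← Finset.mul_sum, sum_const,
        card_univ, nsmul_eq_mul]
      have hs : ∑ v, μ v = Fintype.card V * mbar := by rw [hmbar]; field_simp
      rw [hs]; ring
    have hsq : ∑ v, μ v ^ 2 ≤ ∑ v, μ v :=
      sum_le_sum fun v _ => by nlinarith [hμ0 v, hμ1 v]
    have hs : ∑ v, μ v = Fintype.card V * mbar := by rw [hmbar]; field_simp
    nlinarith [sq_nonneg mbar, hVR]
  -- divide `h` by `|V|`
  have hY : (0 : ℝ) ≤ Fintype.card Y := Nat.cast_nonneg _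
  have hk : (0 : ℝ) ≤ k := Nat.cast_nonneg _
  have : (∑ y, (∑ i, φ (X i y)) ^ 2) * Fintype.card V ≤
      (Fintype.card Y * (k * mbar)) * Fintype.card V := by
    rw [h]
    calc (Fintype.card Y : ℝ) * (k * ∑ v, φ v ^ 2) ≤ Fintype.card Y * (k * (Fintype.card V * mbar)) := by
          gcongr
      _ = Fintype.card Y * (k * mbar) * Fintype.card V := by ring
  exact le_of_mul_le_mul_right this hVR

/-- **Hitting / sampling for measures.** Under the same hypotheses, the seeds on which the samples
collect at most half the expected mass are few: `#{y | ∑_i μ(X_i y) ≤ k μ̄ / 2} · (k μ̄) ≤ 4 |Y|`.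
For the indicator of a set of density `δ` this is the hitter property with failure probability
`≤ 4/(k δ)`. [cite: Hirahara2022PartialMCSP, proof of Lemma 8.1 (pairwise-independent hitter, k = 1/εδ)] -/
theorem card_sum_le_half_mul_le (h1 : Uniform1 X) (h2 : Uniform2 X) (μ : V → ℝ) (hμ0 : ∀ v, 0 ≤ μ v)
    (hμ1 : ∀ v, μ v ≤ 1) (hV : 0 < Fintype.card V) :
    ((univ.filter fun y => ∑ i, μ (X i y) ≤ k * ((∑ v, μ v) / Fintype.card V) / 2).card : ℝ) *
      (k * ((∑ v, μ v) / Fintype.card V)) ≤ 4 * Fintype.card Y := by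
  set E := (k : ℝ) * ((∑ v, μ v) / Fintype.card V) with hE
  set B := univ.filter fun y => ∑ i, μ (X i y) ≤ E / 2 with hB
  have hE0 : 0 ≤ E := by
    have hVR : (0 : ℝ) < Fintype.card V := by exact_mod_cast hV
    have : 0 ≤ ∑ v, μ v := sum_nonneg fun v _ => hμ0 v
    positivity
  -- on `B` the squared deviation is `≥ (E/2)²`
  have hdev : (B.card : ℝ) * (E / 2) ^ 2 ≤ ∑ y, (∑ i, μ (X i y) - E) ^ 2 := by
    calc (B.card : ℝ) * (E / 2) ^ 2 = ∑ _y ∈ B, (E / 2) ^ 2 := by rw [sum_const, nsmul_eq_mul]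
      _ ≤ ∑ y ∈ B, (∑ i, μ (X i y) - E) ^ 2 := sum_le_sum fun y hy => by
          have hy' := (mem_filter.1 hy).2
          nlinarith
      _ ≤ ∑ y, (∑ i, μ (X i y) - E) ^ 2 :=
          sum_le_sum_of_subset_of_nonneg (filter_subset _ _) fun y _ _ => sq_nonneg _
  have hch := sum_sq_dev_le h1 h2 μ hμ0 hμ1 hV
  rw [← hE] at hch
  have h : (B.card : ℝ) * (E / 2) ^ 2 ≤ Fintype.card Y * E := hdev.trans hch
  -- `card · E² / 4 ≤ |Y| E` ⇒ `card · E ≤ 4 |Y|` (trivial if `E = 0`)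
  rcases hE0.eq_or_lt with hE0' | hEpos
  · rw [← hE0']; simp
  · have : (B.card : ℝ) * E * E ≤ 4 * Fintype.card Y * E := by nlinarith
    exact le_of_mul_le_mul_right this hEpos

end PairwiseUniform

/-! ### The Hankel (Toeplitz) system is solvable for a nonzero multiplier -/

namespace Hankel

variable {N m : ℕ}

/-- The Hankel product `(H_t x)_r = ∑_{c<m} t_{r+c} x_c` for `t ∈ 𝔽₂^{N+m}`, `x ∈ 𝔽₂ᵐ`.
[cite: Hirahara2022PartialMCSP, proof of Lemma 8.1 (Toeplitz matrices)] -/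
def mulVec (t : Fin (N + m) → ZMod 2) (x : Fin m → ZMod 2) : Fin N → ZMod 2 :=
  fun r => ∑ c : Fin m, t ⟨r + c, by omega⟩ * x c

/-- `H_t x` is additive in `t`. [folklore] -/
theorem mulVec_add (t t' : Fin (N + m) → ZMod 2) (x : Fin m → ZMod 2) :
    mulVec (t + t') x = mulVec t x + mulVec t' x := by
  funext r; simp [mulVec, add_mul, Finset.sum_add_distrib]

/-- `H_0 x = 0`. [folklore] -/
@[simp] theorem mulVec_zero_left (x : Fin m → ZMod 2) : mulVec (0 : Fin (N + m) → ZMod 2) x = 0 := by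
  funext r; simp [mulVec]

/-- Back-substitution along the pivots `c₀ + r`: the bits `t_n` of a solution of `H_t x = y`, for a
multiplier `x` with top nonzero coordinate `c₀` (`x_{c₀} = 1`, `x_c = 0` for `c > c₀`), defined by
well-founded recursion on `n`. [folklore] -/
noncomputable def solve (x : Fin m → ZMod 2) (y : Fin N → ZMod 2) (c₀ : ℕ) : ℕ → ZMod 2 :=
  fun n =>
    if h : c₀ ≤ n ∧ n - c₀ < N then
      y ⟨n - c₀, h.2⟩ -
        ∑ c : Fin m, if _hc : (c : ℕ) < c₀ then solve x y c₀ (n - c₀ + c) * x c else 0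
    else 0
  termination_by n => n
  decreasing_by omega

/-- The defining equation of `solve` at a pivot index `n = r + c₀`, `r < N`. [folklore] -/
theorem solve_pivot (x : Fin m → ZMod 2) (y : Fin N → ZMod 2) (c₀ : ℕ) (r : Fin N) :
    solve x y c₀ (r + c₀) =
      y r - ∑ c : Fin m, if (c : ℕ) < c₀ then solve x y c₀ (r + c) * x c else 0 := by
  rw [solve]
  rw [dif_pos ⟨by omega, by simp⟩]
  simp only [Nat.add_sub_cancel, dite_eq_ite]

/-- **Solvability.** If `x_{c₀} = 1` and `x_c = 0` for `c₀ < c`, the vector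
`t_n := solve … n` (`n < N + m`) solves `H_t x = y`. [folklore] -/
theorem mulVec_solve (x : Fin m → ZMod 2) (y : Fin N → ZMod 2) {c₀ : ℕ} (hc₀ : c₀ < m)
    (hx₀ : x ⟨c₀, hc₀⟩ = 1) (hx : ∀ c : Fin m, c₀ < (c : ℕ) → x c = 0) :
    mulVec (fun n : Fin (N + m) => solve x y c₀ n) x = y := by
  funext r
  unfold mulVec
  simp only
  -- split the summand: the part below the pivot, the pivot, and zero above it
  have hsplit : ∀ c : Fin m, solve x y c₀ ((r : ℕ) + c) * x c =
      (if (c : ℕ) < c₀ then solve x y c₀ ((r : ℕ) + c) * x c else 0) +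
        (if c = ⟨c₀, hc₀⟩ then solve x y c₀ ((r : ℕ) + c₀) else 0) := by
    intro c
    rcases lt_trichotomy (c : ℕ) c₀ with h | h | h
    · rw [if_pos h, if_neg (fun heq => by rw [heq] at h; exact lt_irrefl _ h), add_zero]
    · have hc : c = ⟨c₀, hc₀⟩ := Fin.ext h
      subst hc
      rw [if_neg (lt_irrefl _), if_pos rfl, zero_add, hx₀, mul_one]
    · rw [if_neg (by omega), if_neg (fun heq => by rw [heq] at h; exact lt_irrefl _ h), hx c h,
        mul_zero, add_zero]
  rw [Finset.sum_congr rfl fun c _ => hsplit c, Finset.sum_add_distrib, Finset.sum_ite_eq' univ,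
    if_pos (mem_univ _), solve_pivot]
  abel

/-- Every `x ≠ 0` has a top nonzero coordinate, at which it is `1` (over `𝔽₂`). [folklore] -/
theorem exists_top (x : Fin m → ZMod 2) (hx : x ≠ 0) :
    ∃ (c₀ : ℕ) (hc₀ : c₀ < m), x ⟨c₀, hc₀⟩ = 1 ∧ ∀ c : Fin m, c₀ < (c : ℕ) → x c = 0 := by
  classical
  have hne : (univ.filter fun c : Fin m => x c ≠ 0).Nonempty := by
    by_contra h
    rw [Finset.not_nonempty_iff_eq_empty, Finset.filter_eq_empty_iff] at h
    exact hx (funext fun c => by simpa using h (mem_univ c))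
  set c₀ := (univ.filter fun c : Fin m => x c ≠ 0).max' hne with hc₀
  have hmem := Finset.max'_mem _ hne
  rw [← hc₀, mem_filter] at hmem
  refine ⟨c₀, c₀.isLt, ?_, fun c hc => ?_⟩
  · have h01 : ∀ z : ZMod 2, z ≠ 0 → z = 1 := by decide
    exact h01 _ hmem.2
  · by_contra hxc
    have hle : c ≤ c₀ := Finset.le_max' _ c (mem_filter.2 ⟨mem_univ _, hxc⟩)
    exact absurd hc (not_lt.2 hle)

/-- **The Hankel system `H_t x = y` is solvable for every `x ≠ 0` and every `y`.** [cite: Hirahara2022PartialMCSP, proof of Lemma 8.1 (Toeplitz hitter)] -/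
theorem exists_solve (x : Fin m → ZMod 2) (hx : x ≠ 0) (y : Fin N → ZMod 2) :
    ∃ t : Fin (N + m) → ZMod 2, mulVec t x = y := by
  obtain ⟨c₀, hc₀, hx₀, hx'⟩ := exists_top x hx
  exact ⟨_, mulVec_solve x y hc₀ hx₀ hx'⟩

/-! ### The generator and its pairwise independence -/

variable (N m)

/-- Seeds: Hankel bits and a shift, `(N + m) + N` bits. [cite: Hirahara2022PartialMCSP, proof of Lemma 8.1 (r ∈ {0,1}^{3n})] -/
abbrev Seed : Type := (Fin (N + m) → ZMod 2) × (Fin N → ZMod 2)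

variable {N m}

/-- The generator: `gen idx (t, b) i = H_t (idx i) + b` for an indexing `idx : Fin k → 𝔽₂ᵐ` of the
sample positions. [cite: Hirahara2022PartialMCSP, proof of Lemma 8.1 (pairwise-independent hitter H)] -/
def gen {k : ℕ} (idx : Fin k → Fin m → ZMod 2) (s : Seed N m) (i : Fin k) : Fin N → ZMod 2 :=
  mulVec s.1 (idx i) + s.2

/-- Evaluation at one index, as an additive homomorphism of the seed. [folklore] -/
def evalHom (c : Fin m → ZMod 2) : Seed N m →+ (Fin N → ZMod 2) where
  toFun s := mulVec s.1 c + s.2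
  map_zero' := by simp
  map_add' s s' := by
    simp only [Prod.fst_add, Prod.snd_add, mulVec_add]; abel

/-- Evaluation at two indices, as an additive homomorphism of the seed. [folklore] -/
def evalPairHom (c c' : Fin m → ZMod 2) : Seed N m →+ (Fin N → ZMod 2) × (Fin N → ZMod 2) where
  toFun s := (mulVec s.1 c + s.2, mulVec s.1 c' + s.2)
  map_zero' := by simp
  map_add' s s' := by
    simp only [Prod.fst_add, Prod.snd_add, mulVec_add, Prod.mk_add_mk, Prod.mk.injEq]
    constructor <;> abel

/-- One-point evaluation is onto (`b := v`). [folklore] -/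
theorem evalHom_surjective (c : Fin m → ZMod 2) : Function.Surjective (evalHom (N := N) c) :=
  fun v => ⟨(0, v), by simp [evalHom]⟩

/-- Two-point evaluation is onto for distinct indices (solve `H_t (c - c') = v - w`, then shift).
[cite: Hirahara2022PartialMCSP, proof of Lemma 8.1 (pairwise independence of the Toeplitz hitter)] -/
theorem evalPairHom_surjective {c c' : Fin m → ZMod 2} (hcc' : c ≠ c') :
    Function.Surjective (evalPairHom (N := N) c c') := by
  rintro ⟨v, w⟩
  obtain ⟨t, ht⟩ := exists_solve (c - c') (sub_ne_zero.2 hcc') (v - w)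
  refine ⟨(t, v - mulVec t c), ?_⟩
  have hsub : mulVec t (c - c') = mulVec t c - mulVec t c' := by
    funext r; simp [mulVec, mul_sub, Finset.sum_sub_distrib]
  rw [hsub] at ht
  simp only [evalPairHom, AddMonoidHom.coe_mk, ZeroHom.coe_mk, Prod.mk.injEq]
  constructor
  · abel
  · have : mulVec t c' = mulVec t c - (v - w) := by rw [← ht]; abel
    rw [this]; abel

/-- **One-point uniformity**: `#{s | gen s i = v} · 2ᴺ = |Seed|`. [cite: AroraBarak2009, Def. 8.14] -/
theorem card_filter_gen_eq {k : ℕ} (idx : Fin k → Fin m → ZMod 2) (i : Fin k) (v : Fin N → ZMod 2) :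
    (univ.filter fun s : Seed N m => gen idx s i = v).card * 2 ^ N = Fintype.card (Seed N m) := by
  have h := Literature.Computability.AlgebraicComplexity.card_filter_mul_card_eq_card_of_surjective
    (evalHom (N := N) (idx i)) (evalHom_surjective _) v
  simpa [Fintype.card_fun, ZMod.card, evalHom, gen] using h

/-- **Pairwise independence**: for `idx i ≠ idx j`, `#{s | gen s i = v ∧ gen s j = w} · 4ᴺ = |Seed|`.
[cite: Hirahara2022PartialMCSP, proof of Lemma 8.1 (pairwise-independent hitter)] -/
theorem card_filter_gen_pair {k : ℕ} (idx : Fin k → Fin m → ZMod 2) {i j : Fin k} (hij : idx i ≠ idx j)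
    (v w : Fin N → ZMod 2) :
    (univ.filter fun s : Seed N m => gen idx s i = v ∧ gen idx s j = w).card * (2 ^ N * 2 ^ N) =
      Fintype.card (Seed N m) := by
  have h := Literature.Computability.AlgebraicComplexity.card_filter_mul_card_eq_card_of_surjective
    (evalPairHom (N := N) (idx i) (idx j)) (evalPairHom_surjective hij) (v, w)
  simpa [Fintype.card_fun, ZMod.card, Fintype.card_prod, Prod.ext_iff, evalPairHom, gen] using h

/-- The generator is a singly and pairwise uniform family (for an injective indexing).
[cite: Hirahara2022PartialMCSP, proof of Lemma 8.1] -/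
theorem uniform_gen {k : ℕ} {idx : Fin k → Fin m → ZMod 2} (hidx : Function.Injective idx) :
    PairwiseUniform.Uniform1 (fun i (s : Seed N m) => gen idx s i) ∧
      PairwiseUniform.Uniform2 (fun i (s : Seed N m) => gen idx s i) := by
  constructor
  · intro i v
    have h := card_filter_gen_eq idx i v
    rwa [Fintype.card_fun, ZMod.card, Fintype.card_fin]
  · intro i j hij v w
    have h := card_filter_gen_pair idx (hidx.ne hij) v w
    rwa [Fintype.card_fun, ZMod.card, Fintype.card_fin]

/-- **Hitting property of the Hankel generator for measures**: for an injective indexing of `k`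
positions and `μ : 𝔽₂ᴺ → [0,1]` with mean `μ̄`, the seeds whose `k` samples collect mass
`≤ k μ̄ / 2` number at most `4 |Seed| / (k μ̄)`; for a set of density `δ` and `k ≥ 4/(εδ)` this is
failure probability `≤ ε`. [cite: Hirahara2022PartialMCSP, proof of Lemma 8.1 ("for k := 1/εδ … with probability at least 1 − ε … there exists i such that H(r)ᵢ ∈ X")] -/
theorem card_sum_le_half_mul_le {k : ℕ} {idx : Fin k → Fin m → ZMod 2} (hidx : Function.Injective idx)
    (μ : (Fin N → ZMod 2) → ℝ) (hμ0 : ∀ v, 0 ≤ μ v) (hμ1 : ∀ v, μ v ≤ 1) :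
    ((univ.filter fun s : Seed N m =>
        ∑ i, μ (gen idx s i) ≤ k * ((∑ v, μ v) / Fintype.card (Fin N → ZMod 2)) / 2).card : ℝ) *
      (k * ((∑ v, μ v) / Fintype.card (Fin N → ZMod 2))) ≤ 4 * Fintype.card (Seed N m) := by
  obtain ⟨h1, h2⟩ := uniform_gen (N := N) hidx
  exact PairwiseUniform.card_sum_le_half_mul_le h1 h2 μ hμ0 hμ1 Fintype.card_pos

end Hankel

end Literature.Computability.Complexity
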